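import Literature.Claims.NS.Kosovtsov2022
import Literature.Analysis.FluidPDE.PineauVicolPressureDerivativesDecay
import Literature.Analysis.FluidPDE.LeraySchemePressure
import Literature.Analysis.FluidPDE.TsaiSelfSimilarBounded
import Literature.Analysis.FluidPDE.NewtonKernel
import Literature.Analysis.FluidPDE.EnergyUniqueness
import HarnessLib

/-!
# Salvage C33 `Kosovtsov2022` — the TRUE typed step: the Leray pressure of a Schwartz field (Step 1)

Cell ns-claims (D-0090), salvage seat ns-claims-salvage-p1 (g2). The typed skeleton
`Literature.Claims.NS.Kosovtsov2022` (Yu. N. Kosovtsov, arXiv:2209.06587 v3) asserts in Step 1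
((4)–(7) p. 1–2, p. 8 l. 3–5: «the well known Poisson equation, whose solution in ℝ³ [Majda] has the
form (5)») that for every smooth, rapidly decreasing, divergence-free `u : ℝ³ → ℝ³` the Leray pressure
— a smooth BOUNDED solution `p` of `Δp = −Σᵢⱼ ∂ᵢuⱼ ∂ⱼuᵢ` tending to `0` at infinity — exists, is
unique, and makes `F(u) = νΔu − (u·∇)u − ∇p` smooth. This is TRUE and classical (Majda–Bertozzi
§1.8: the Poisson equation (1.84) `−Δp = tr(∇v)²`, its Newtonian-potential solution Lemma 1.6
(1.85)–(1.88), Leray's formulation Prop. 1.15; Liouville for the homogeneous part); here it is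
discharged in the kernel from tree facts only — together with Step 4, the energy identity (21) at the
one element `u` (Majda–Bertozzi §3.1.1), which is the (true) printed support of the dissipativity
sentence Step 5:

* existence: `p_u := pressurePotential u` (the tree's Calderón–Zygmund pressure
  `−Γ₀ ⋆ ∂ᵢ∂ⱼ(uᵢuⱼ) − D²Γ∞ ⋆ (u ⊗ u)`, `PressureRepresentation`), which on the decay class is `C^∞`
  (`PineauVicol2026.contDiff_pressurePotential_decay_top`), solves `ΔQ[u] = −∂ᵢ∂ⱼ(uᵢuⱼ)`
  (`PineauVicol2026.laplacian_pressurePotential_decay`) and obeys `|DᵏQ[u](x)| ≲ (1+|x|)^{−k−2}`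
  (`PineauVicol2026.exists_bound_norm_iteratedFDeriv_pressurePotential_decay`); for divergence-free
  `u`, `∂ᵢ∂ⱼ(uᵢuⱼ) = Σᵢⱼ ∂ᵢuⱼ∂ⱼuᵢ` (`divergence_convect_eq_sum`);
* uniqueness: the difference of two Leray pressures is bounded harmonic, hence constant
  (`isConst_of_harmonic_bounded`, Liouville), and tends to `0`, hence vanishes;
* smoothness of `F(u)`: `contDiff_laplacian`, `contDiff_convect_self`, `contDiff_gradient`.

Main: `step1_holds : Literature.Claims.NS.Kosovtsov2022.Step_1` and
`step4_holds : Literature.Claims.NS.Kosovtsov2022.Step_4` (`∫⟪νΔu − (u·∇)u − ∇p_u, u⟫ = −ν Σᵢⱼ∫(∂ⱼuᵢ)²`,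
from the tree's whole-space integrations by parts `integral_inner_laplacian_self_eq_neg_gradNormSq`,
`integral_inner_fderiv_apply_self_eq_zero`, `integral_inner_gradient_eq_zero`); by-products
`isLerayPressure_pressurePotential`, `isLerayPressure_unique`, `eq_pressurePotential_of_isLerayPressure`
(every Leray pressure IS the Calderón–Zygmund pressure), `exists_bound_gradient_of_isLerayPressure`
(its gradient is bounded — the input the energy identity (21) = `Step_4` needs).

WHAT THIS IS NOT: not a claim about NS regularity or blow-up; not a claim about any author beyond the
typed locator.
-/

noncomputable section

open MeasureTheory Set Filter Topology
open scoped ContDiff Laplacian InnerProductSpace RealInnerProductSpace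

set_option linter.dupNamespace false

namespace Summit.NavierStokesRegularity.NavierStokesRegularity.Theorems.Kosovtsov2022

open Literature.Analysis.FluidPDE Literature.Analysis.FluidPDE.PineauVicol2026
open Literature.Claims.NS.Kosovtsov2022

/-! ## Decay bookkeeping: from `HasRapidSpatialDecay` to the weighted bounds of the decay class -/

/-- A rapidly decaying field has ONE constant bounding `(1+|y|)^{j+1} ‖Dʲu(y)‖` for all `j ≤ m`.
[cite: Kosovtsov2022, §2 p.3 («|x|^p D^α u(x) → 0 … for all α»)] -/
theorem exists_weightedBound_of_hasRapidSpatialDecay {u : Euc 3 → Euc 3} (hu : HasRapidSpatialDecay u)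
    (m : ℕ) : ∃ C : ℝ, ∀ j ≤ m, ∀ y, (1 + ‖y‖) ^ (j + 1) * ‖iteratedFDeriv ℝ j u y‖ ≤ C := by
  choose C hC using fun j : ℕ => hu j (j + 1)
  refine ⟨∑ i ∈ Finset.range (m + 1), |C i|, fun j hj y => ?_⟩
  calc (1 + ‖y‖) ^ (j + 1) * ‖iteratedFDeriv ℝ j u y‖ ≤ C j := hC j y
    _ ≤ |C j| := le_abs_self _
    _ ≤ ∑ i ∈ Finset.range (m + 1), |C i| :=
        Finset.single_le_sum (f := fun i => |C i|) (fun i _ => abs_nonneg (C i))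
          (Finset.mem_range.2 (Nat.lt_succ_of_le hj))

/-- A rapidly decaying field obeys the Type-I-class bound `‖u(y)‖ ≤ C/(1+|y|)`. [folklore] -/
theorem exists_decayBound_of_hasRapidSpatialDecay {u : Euc 3 → Euc 3} (hu : HasRapidSpatialDecay u) :
    ∃ C : ℝ, ∀ y, ‖u y‖ ≤ C / (1 + ‖y‖) := by
  obtain ⟨C, hC⟩ := hu 0 1
  refine ⟨C, fun y => ?_⟩
  have h := hC y
  rw [norm_iteratedFDeriv_zero, pow_one] at h
  rw [le_div_iff₀ (by positivity)]
  linarith [mul_comm (1 + ‖y‖) ‖u y‖]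

/-! ## The quadratic source of a divergence-free field in coordinates -/

/-- For `u ∈ C²` divergence free, `∂ᵢ∂ⱼ(uᵢuⱼ) = div((u·∇)u) = Σᵢ Σⱼ ∂ᵢuⱼ ∂ⱼuᵢ = tr (Du)²` — the
right-hand side of the pressure Poisson equation (4) in the skeleton's coordinates `pd`.
[cite: Kosovtsov2022, (4) p.2] [cite: MajdaBertozziCUP2002, §1.8 (1.84)] -/
theorem pressureSource_eq_sum_pd {u : Euc 3 → Euc 3} (hu : ContDiff ℝ 2 u) (hdiv : NSWave0.IsDivFree u)
    (x : Euc 3) : pressureSource u x = ∑ i, ∑ j, pd i j u x * pd j i u x := by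
  have hdiv' : VectorCalculus.IsDivFree u := hdiv
  rw [pressureSource_eq_of_isDivFree hdiv',
    divergence_convect_eq_sum (EuclideanSpace.basisFun (Fin 3) ℝ) hu (hu.of_le one_le_two) hdiv' x]
  refine Finset.sum_congr rfl fun i _ => ?_
  set T : (Euc 3) →L[ℝ] (Euc 3) := fderiv ℝ u x with hT
  set b := EuclideanSpace.basisFun (Fin 3) ℝ with hb
  have hexp : T (b i) = ∑ j, (T (b i)) j • b j := by
    conv_lhs => rw [← b.sum_repr (T (b i))]
    simp only [hb, EuclideanSpace.basisFun_repr]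
  have hinner : ∀ v : Euc 3, ⟪b i, v⟫ = v i := fun v => by
    rw [← OrthonormalBasis.repr_apply_apply, hb, EuclideanSpace.basisFun_repr]
  calc ⟪b i, T (T (b i))⟫ = ⟪b i, T (∑ j, (T (b i)) j • b j)⟫ := by rw [← hexp]
    _ = ∑ j, (T (b i)) j * (T (b j)) i := by
        rw [map_sum, inner_sum]
        refine Finset.sum_congr rfl fun j _ => ?_
        rw [map_smul, inner_smul_right, hinner]
    _ = ∑ j, pd i j u x * pd j i u x := by
        refine Finset.sum_congr rfl fun j _ => ?_
        simp only [pd, basisVec, hT, hb, EuclideanSpace.basisFun_apply]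

/-! ## Existence: the Calderón–Zygmund pressure is a Leray pressure -/

/-- **Existence.** For a smooth, rapidly decreasing, divergence-free `u`, the tree's Calderón–Zygmund
pressure `p_u = Q[u] = Σ RᵢRⱼ(uᵢuⱼ)` is smooth, solves the Poisson equation (4)
`Δp = −Σᵢⱼ ∂ᵢuⱼ ∂ⱼuᵢ`, is bounded, and tends to `0` at infinity (indeed `|Q[u](x)| ≲ (1+|x|)⁻²`).
[cite: Kosovtsov2022, (4)–(5) p.2; p.8 l.3–5] [cite: MajdaBertozziCUP2002, §1.8 (1.84)–(1.88), Lemma 1.6] -/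
theorem isLerayPressure_pressurePotential {u : Euc 3 → Euc 3} (hu : AdmDF u) :
    IsLerayPressure u (pressurePotential u) := by
  obtain ⟨⟨hsm, hdec⟩, hdiv⟩ := hu
  obtain ⟨C₀, hC₀⟩ := exists_decayBound_of_hasRapidSpatialDecay hdec
  obtain ⟨C, hC⟩ := exists_weightedBound_of_hasRapidSpatialDecay hdec 2
  obtain ⟨A, hA0, hA⟩ := exists_bound_norm_iteratedFDeriv_pressurePotential_decay 0
  have hbound : ∀ x, |pressurePotential u x| ≤ A * C ^ 2 / (1 + ‖x‖) ^ 2 := by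
    intro x
    have h := hA u C hsm (fun j hj y => hC j (by omega) y) x
    rwa [norm_iteratedFDeriv_zero, Real.norm_eq_abs] at h
  have hAC : 0 ≤ A * C ^ 2 := by positivity
  refine ⟨contDiff_pressurePotential_decay_top hsm hC₀, fun x => ?_, ⟨A * C ^ 2, fun x => ?_⟩, ?_⟩
  · rw [laplacian_pressurePotential_decay (contDiff_infty.1 hsm 4) hC₀ x,
      pressureSource_eq_sum_pd (contDiff_infty.1 hsm 2) hdiv x]
  · exact (hbound x).trans (div_le_self hAC (one_le_pow₀ (by linarith [norm_nonneg x])))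
  · have h1 : Tendsto (fun x : (Euc 3) => (1 + ‖x‖) ^ 2) (cocompact (Euc 3)) atTop :=
      (tendsto_pow_atTop two_ne_zero).comp
        (tendsto_atTop_add_const_left _ 1 tendsto_norm_cocompact_atTop)
    have h2 : Tendsto (fun x : (Euc 3) => A * C ^ 2 / (1 + ‖x‖) ^ 2) (cocompact (Euc 3)) (𝓝 0) :=
      tendsto_const_nhds.div_atTop h1
    exact squeeze_zero_norm (fun x => by rw [Real.norm_eq_abs]; exact hbound x) h2

/-! ## Uniqueness (Liouville) -/

/-- **Uniqueness.** Two Leray pressures of the same field coincide: their difference is a bounded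
harmonic function on `ℝ³`, hence constant (Liouville), and tends to `0` at infinity, hence vanishes —
«the solution in ℝ³» of (4) is unique in the bounded class vanishing at infinity.
[cite: Kosovtsov2022, (4)–(5) p.2] [cite: GilbargTrudinger2001, Thm 2.10] -/
theorem isLerayPressure_unique {u : Euc 3 → Euc 3} {p p' : Euc 3 → ℝ} (hp : IsLerayPressure u p)
    (hp' : IsLerayPressure u p') : p = p' := by
  obtain ⟨hps, hpΔ, ⟨C, hC⟩, hp0⟩ := hp
  obtain ⟨hp's, hp'Δ, ⟨C', hC'⟩, hp'0⟩ := hp'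
  have h2 : ContDiff ℝ 2 p := contDiff_infty.1 hps 2
  have h2' : ContDiff ℝ 2 p' := contDiff_infty.1 hp's 2
  have hΔ : Δ (p - p') = 0 := by
    funext x
    rw [h2.contDiffAt.laplacian_sub h2'.contDiffAt, hpΔ x, hp'Δ x, sub_self, Pi.zero_apply]
  have hharm : InnerProductSpace.HarmonicOnNhd (p - p') univ := fun x _ =>
    ⟨(h2.sub h2').contDiffAt, by rw [hΔ]⟩
  have hbdd : ∃ B, ∀ x, |(p - p') x| ≤ B :=
    ⟨C + C', fun x => (abs_sub (p x) (p' x)).trans (add_le_add (hC x) (hC' x))⟩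
  have hconst := isConst_of_harmonic_bounded hharm hbdd
  have hlim : Tendsto (p - p') (cocompact (Euc 3)) (𝓝 0) := by
    have h := hp0.sub hp'0
    rw [sub_zero] at h
    exact h
  have hc : (p - p') = fun _ => (p - p') 0 := funext fun x => hconst x 0
  rw [hc] at hlim
  have h00 : (p - p') 0 = 0 := tendsto_nhds_unique tendsto_const_nhds hlim
  funext x
  have hx := hconst x 0
  rwa [h00, Pi.sub_apply, sub_eq_zero] at hx

/-- **Every Leray pressure is the Calderón–Zygmund pressure** `Q[u]`. [cite: MajdaBertozziCUP2002, §1.8 Lemma 1.6, Prop. 1.15] -/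
theorem eq_pressurePotential_of_isLerayPressure {u : Euc 3 → Euc 3} {p : Euc 3 → ℝ} (hu : AdmDF u)
    (hp : IsLerayPressure u p) : p = pressurePotential u :=
  isLerayPressure_unique hp (isLerayPressure_pressurePotential hu)

/-- **The gradient of the Leray pressure is bounded** (indeed `‖∇p_u(x)‖ ≲ (1+|x|)⁻³`): the input
under which the whole-space integration by parts `∫ ⟪∇p, u⟫ = 0` of the energy identity (21) is
available (`integral_inner_gradient_eq_zero`). [cite: Kosovtsov2022, (21) p.8] [cite: PineauVicol2026, Lemma 8.1 (8.3)] -/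
theorem exists_bound_gradient_of_isLerayPressure {u : Euc 3 → Euc 3} {p : Euc 3 → ℝ} (hu : AdmDF u)
    (hp : IsLerayPressure u p) : ∃ M : ℝ, ∀ x, ‖gradient p x‖ ≤ M := by
  rw [eq_pressurePotential_of_isLerayPressure hu hp]
  obtain ⟨⟨hsm, hdec⟩, -⟩ := hu
  obtain ⟨C, hC⟩ := exists_weightedBound_of_hasRapidSpatialDecay hdec 3
  obtain ⟨A, hA0, hA⟩ := exists_bound_norm_iteratedFDeriv_pressurePotential_decay 1
  refine ⟨A * C ^ 2, fun x => ?_⟩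
  have h := hA u C hsm (fun j hj y => hC j (by omega) y) x
  have hAC : 0 ≤ A * C ^ 2 := by positivity
  calc ‖gradient (pressurePotential u) x‖ = ‖fderiv ℝ (pressurePotential u) x‖ := by
        rw [gradient, LinearIsometryEquiv.norm_map]
    _ = ‖iteratedFDeriv ℝ 1 (pressurePotential u) x‖ := by
        rw [← norm_iteratedFDeriv_fderiv, norm_iteratedFDeriv_zero]
    _ ≤ A * C ^ 2 / (1 + ‖x‖) ^ (1 + 2) := h
    _ ≤ A * C ^ 2 := div_le_self hAC (one_le_pow₀ (by linarith [norm_nonneg x]))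

/-! ## Smoothness of the Leray right-hand side -/

/-- **`F(u) = νΔu − (u·∇)u − ∇p` is smooth** for smooth `u` and a Leray pressure `p` (so the
operator **A** of (17) is defined on the smooth class). [cite: Kosovtsov2022, (6) p.2; (17)–(19) p.7] -/
theorem contDiff_nsF {u : Euc 3 → Euc 3} {p : Euc 3 → ℝ} (hu : ContDiff ℝ ∞ u) (hp : ContDiff ℝ ∞ p) (ν : ℝ) :
    ContDiff ℝ ∞ (nsF ν u p) := by
  have hu' : ∀ m : ℕ∞, ContDiff ℝ (m : ℕ∞ω) u := fun m => hu.of_le (mod_cast le_top)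
  have hp' : ∀ m : ℕ∞, ContDiff ℝ (m : ℕ∞ω) p := fun m => hp.of_le (mod_cast le_top)
  have hΔ : ContDiff ℝ ∞ (Δ u) := contDiff_laplacian (hu' (⊤ + 2))
  have hc : ContDiff ℝ ∞ (convect u u) := contDiff_convect_self (hu' (⊤ + 1))
  have hg : ContDiff ℝ ∞ (gradient p) := Literature.Analysis.FluidPDE.contDiff_gradient (hp' (⊤ + 1))
  have e : nsF ν u p = fun x => ν • Δ u x - convect u u x - gradient p x := rfl
  rw [e]
  exact ((hΔ.const_smul ν).sub hc).sub hg

/-! ## Step 1 holds -/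

/-- **Step 1 of the skeleton holds**: existence and uniqueness of the Leray pressure and smoothness of
`F(u)` for every smooth rapidly decreasing divergence-free `u`. [cite: Kosovtsov2022, (4)–(7) p.1–2; p.8 l.3–5] -/
theorem step1_holds : Step_1 := by
  intro u hu
  refine ⟨⟨pressurePotential u, isLerayPressure_pressurePotential hu⟩,
    fun p p' hp hp' => isLerayPressure_unique hp hp', fun ν p hp => contDiff_nsF hu.1.1 hp.1 ν⟩

/-! ## Step 4: the energy identity (21) at the one element `u` -/

/-- Rapid decay in the `rpow` weight convention used by the tree's whole-space integrations by parts: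
one constant `C ≥ 0` with `‖u‖, ‖Du‖, ‖D²u‖ ≤ C (1+|x|)⁻⁵`. [folklore] -/
theorem exists_rpowDecay_of_hasRapidSpatialDecay {u : Euc 3 → Euc 3} (hdec : HasRapidSpatialDecay u) :
    ∃ C : ℝ, 0 ≤ C ∧ (∀ x, ‖u x‖ ≤ C * (1 + ‖x‖) ^ (-(5 : ℝ))) ∧
      (∀ x, ‖fderiv ℝ u x‖ ≤ C * (1 + ‖x‖) ^ (-(5 : ℝ))) ∧
      (∀ x, ‖fderiv ℝ (fderiv ℝ u) x‖ ≤ C * (1 + ‖x‖) ^ (-(5 : ℝ))) := by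
  obtain ⟨C₀, h₀⟩ := hdec 0 5
  obtain ⟨C₁, h₁⟩ := hdec 1 5
  obtain ⟨C₂, h₂⟩ := hdec 2 5
  have hw : ∀ x : Euc 3, 0 ≤ (1 + ‖x‖) ^ (-(5 : ℝ)) := fun x => Real.rpow_nonneg (by positivity) _
  have conv : ∀ {x : Euc 3} {a Ci : ℝ}, (1 + ‖x‖) ^ 5 * a ≤ Ci →
      a ≤ (|C₀| + |C₁| + |C₂|) * (1 + ‖x‖) ^ (-(5 : ℝ)) ∨ ¬ Ci ≤ |C₀| + |C₁| + |C₂| := by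
    intro x a Ci h
    by_cases hCi : Ci ≤ |C₀| + |C₁| + |C₂|
    · left
      have h' := le_mul_rpow_neg_of_pow_mul_le h
      simp only [Nat.cast_ofNat] at h'
      exact h'.trans (mul_le_mul_of_nonneg_right hCi (hw x))
    · right; exact hCi
  refine ⟨|C₀| + |C₁| + |C₂|, by positivity, fun x => ?_, fun x => ?_, fun x => ?_⟩
  · have h := h₀ x
    rw [norm_iteratedFDeriv_zero] at h
    rcases conv h with h' | h'
    · exact h'
    · exact absurd (by linarith [le_abs_self C₀, abs_nonneg C₁, abs_nonneg C₂]) h'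
  · have h := h₁ x
    rw [← norm_iteratedFDeriv_fderiv, norm_iteratedFDeriv_zero] at h
    rcases conv h with h' | h'
    · exact h'
    · exact absurd (by linarith [le_abs_self C₁, abs_nonneg C₀, abs_nonneg C₂]) h'
  · have h := h₂ x
    rw [← norm_iteratedFDeriv_fderiv, ← norm_iteratedFDeriv_fderiv, norm_iteratedFDeriv_zero] at h
    rcases conv h with h' | h'
    · exact h'
    · exact absurd (by linarith [le_abs_self C₂, abs_nonneg C₀, abs_nonneg C₁]) h'

/-- **`∫ |∇u|² = Σᵢ Σⱼ ∫ (∂ⱼuᵢ)²`** in the skeleton's coordinates, for a rapidly decaying smooth field.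
[cite: Kosovtsov2022, (21) p.8] -/
theorem gradNormSq_eq_sum_pd {u : Euc 3 → Euc 3} (hsm : ContDiff ℝ ∞ u) (hdec : HasRapidSpatialDecay u) :
    VectorCalculus.gradNormSq u = ∑ i, ∑ j, ∫ x, (pd j i u x) ^ 2 := by
  obtain ⟨C, hC0, -, h1, -⟩ := exists_rpowDecay_of_hasRapidSpatialDecay hdec
  set b := EuclideanSpace.basisFun (Fin 3) ℝ with hb
  have hDc : Continuous (fderiv ℝ u) := hsm.continuous_fderiv (by simp)
  -- each `(∂ᵢuⱼ)²` is continuous and integrable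
  have hpdc : ∀ i j, Continuous fun x => (pd i j u x) ^ 2 := by
    intro i j
    have h : Continuous fun x => fderiv ℝ u x (basisVec i) := hDc.clm_apply continuous_const
    exact ((EuclideanSpace.proj j).continuous.comp h).pow 2
  have hpd_le : ∀ i j x, (pd i j u x) ^ 2 ≤ ‖fderiv ℝ u x‖ ^ 2 := by
    intro i j x
    have hbi : (basisVec i : Euc 3) = b i := by rw [hb, EuclideanSpace.basisFun_apply]; rfl
    have h1 : |pd i j u x| ≤ ‖fderiv ℝ u x (basisVec i)‖ := by
      have h := PiLp.norm_apply_le (fderiv ℝ u x (basisVec i)) j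
      rwa [Real.norm_eq_abs] at h
    have h2 : ‖fderiv ℝ u x (basisVec i)‖ ≤ ‖fderiv ℝ u x‖ := by
      rw [hbi]; exact norm_apply_orthonormalBasis_le b i _
    calc (pd i j u x) ^ 2 = |pd i j u x| ^ 2 := (sq_abs _).symm
      _ ≤ ‖fderiv ℝ u x‖ ^ 2 := pow_le_pow_left₀ (abs_nonneg _) (h1.trans h2) 2
  have hr3 : (Module.finrank ℝ (Euc 3) : ℝ) < 5 := by simp; norm_num
  have hpdI : ∀ i j, Integrable (fun x => (pd i j u x) ^ 2) (volume : Measure (Euc 3)) := by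
    intro i j
    refine integrable_of_norm_le_rpow_neg (hpdc i j) (C := C * C) hr3 fun x => ?_
    rw [Real.norm_eq_abs, abs_of_nonneg (sq_nonneg _)]
    calc (pd i j u x) ^ 2 ≤ ‖fderiv ℝ u x‖ ^ 2 := hpd_le i j x
      _ ≤ (C * (1 + ‖x‖) ^ (-(5 : ℝ))) * (C * (1 + ‖x‖) ^ (-(5 : ℝ))) := by
          rw [sq]; exact mul_le_mul (h1 x) (h1 x) (norm_nonneg _) ((norm_nonneg _).trans (h1 x))
      _ ≤ (C * (1 + ‖x‖) ^ (-(5 : ℝ))) * C :=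
          mul_le_mul_of_nonneg_left (decay_le_const x hC0 (by norm_num))
            ((norm_nonneg _).trans (h1 x))
      _ = C * C * (1 + ‖x‖) ^ (-(5 : ℝ)) := by ring
  -- pointwise: `|Du(x)|_F² = Σᵢ Σⱼ (∂ᵢuⱼ)²`
  have hpt : ∀ x, frobeniusNormSq (fderiv ℝ u x) = ∑ i, ∑ j, (pd i j u x) ^ 2 := by
    intro x
    rw [frobeniusNormSq_eq_sum b]
    refine Finset.sum_congr rfl fun i _ => ?_
    rw [EuclideanSpace.norm_sq_eq]
    refine Finset.sum_congr rfl fun j _ => ?_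
    rw [Real.norm_eq_abs, sq_abs]
    simp only [pd, basisVec, hb, EuclideanSpace.basisFun_apply]
  unfold VectorCalculus.gradNormSq
  simp_rw [hpt]
  rw [integral_finsetSum _ fun i _ => integrable_finsetSum _ fun j _ => hpdI i j, Finset.sum_comm]
  refine Finset.sum_congr rfl fun i _ => ?_
  rw [integral_finsetSum _ fun j _ => hpdI i j]

/-- **Step 4 of the skeleton holds** — the energy identity (21) at the one element `u`:
`⟨Au, u⟩ = ∫ ⟪νΔu − (u·∇)u − ∇p_u, u⟫ = −ν Σᵢⱼ ∫ (∂ⱼuᵢ)²`, by the three whole-space integrations by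
parts `∫⟪Δu,u⟫ = −‖∇u‖²`, `∫⟪(u·∇)u,u⟫ = 0` (`div u = 0`), `∫⟪∇p,u⟫ = 0` (bounded `∇p_u`, `div u = 0`).
This is the TRUE classical support of Step 5 — dissipativity at the single vector `u`, not of **A**.
[cite: Kosovtsov2022, (21) p.8] [cite: MajdaBertozziCUP2002, §3.1.1 p. 87] -/
theorem step4_holds : Step_4 := by
  intro ν _hν u p hu hp
  obtain ⟨M, hM⟩ := exists_bound_gradient_of_isLerayPressure hu hp
  obtain ⟨⟨hsm, hdec⟩, hdiv⟩ := hu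
  have hdiv' : VectorCalculus.IsDivFree u := hdiv
  obtain ⟨C, hC0, h0, h1, h2⟩ := exists_rpowDecay_of_hasRapidSpatialDecay hdec
  have hr3 : (Module.finrank ℝ (Euc 3) : ℝ) < 5 := by simp; norm_num
  have hr4 : (Module.finrank ℝ (Euc 3) : ℝ) + 1 < 5 := by simp; norm_num
  have hu2 : ContDiff ℝ 2 u := contDiff_infty.1 hsm 2
  have hu1 : ContDiff ℝ 1 u := contDiff_infty.1 hsm 1
  have hp1 : ContDiff ℝ 1 p := contDiff_infty.1 hp.1 1
  have hM0 : 0 ≤ M := (norm_nonneg _).trans (hM 0)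
  -- the three whole-space integrations by parts
  have hA : ∫ x, ⟪Δ u x, u x⟫ = -VectorCalculus.gradNormSq u :=
    integral_inner_laplacian_self_eq_neg_gradNormSq hu2 hC0 hr3 h0 h1 h2
  have hB : ∫ x, ⟪fderiv ℝ u x (u x), u x⟫ = 0 :=
    integral_inner_fderiv_apply_self_eq_zero hu1 hu1 hdiv' hC0 hr4 h0 h1 h0 h1
  have hCp : ∫ x, ⟪gradient p x, u x⟫ = 0 :=
    integral_inner_gradient_eq_zero hu1 hp1 hdiv' hr4 h0 h1 hM
  -- integrability of the three pairings
  have huc : Continuous u := hsm.continuous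
  have hDc : Continuous (fderiv ℝ u) := hsm.continuous_fderiv (by simp)
  have iA : Integrable (fun x => ⟪Δ u x, u x⟫) (volume : Measure (Euc 3)) := by
    refine integrable_of_norm_le_decay_mul_decay (C₁ := Module.finrank ℝ (Euc 3) * C) (C₂ := C)
      (r := 5) (r' := 5) ((continuous_laplacian hu2).inner huc) hr3 (by norm_num) (by positivity) hC0
      fun x => (norm_inner_le_norm _ _).trans ?_
    refine mul_le_mul ((norm_laplacian_le u x).trans ?_) (h0 x) (norm_nonneg _) (by positivity)
    rw [mul_assoc]
    exact mul_le_mul_of_nonneg_left (h2 x) (Nat.cast_nonneg _)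
  have iB : Integrable (fun x => ⟪fderiv ℝ u x (u x), u x⟫) (volume : Measure (Euc 3)) := by
    refine integrable_of_norm_le_decay_mul_decay (C₁ := C * C) (C₂ := C) (r := 5) (r' := 5)
      ((hDc.clm_apply huc).inner huc) hr3 (by norm_num) (by positivity) hC0
      fun x => (norm_inner_le_norm _ _).trans ?_
    refine mul_le_mul ?_ (h0 x) (norm_nonneg _) (by positivity)
    calc ‖fderiv ℝ u x (u x)‖ ≤ ‖fderiv ℝ u x‖ * ‖u x‖ := ContinuousLinearMap.le_opNorm _ _
      _ ≤ C * (C * (1 + ‖x‖) ^ (-(5 : ℝ))) :=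
          mul_le_mul ((h1 x).trans (decay_le_const x hC0 (by norm_num))) (h0 x) (norm_nonneg _) hC0
      _ = C * C * (1 + ‖x‖) ^ (-(5 : ℝ)) := by ring
  have iC : Integrable (fun x => ⟪gradient p x, u x⟫) (volume : Measure (Euc 3)) := by
    refine integrable_of_norm_le_const_mul_decay (C₁ := M) (C₂ := C) (r := 5)
      ((continuous_gradient_of_contDiff hp1).inner huc) hr3 fun x => (norm_inner_le_norm _ _).trans ?_
    exact mul_le_mul (hM x) (h0 x) (norm_nonneg _) hM0
  -- split the pairing `⟪F(u), u⟫`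
  have hpt : ∀ x, ⟪nsF ν u p x, u x⟫ =
      ν * ⟪Δ u x, u x⟫ - ⟪fderiv ℝ u x (u x), u x⟫ - ⟪gradient p x, u x⟫ := by
    intro x
    simp only [nsF, convect, inner_sub_left, real_inner_smul_left]
  simp_rw [hpt]
  have i1 : Integrable (fun x => ν * ⟪Δ u x, u x⟫) (volume : Measure (Euc 3)) := iA.const_mul ν
  have i2 : Integrable (fun x => ν * ⟪Δ u x, u x⟫ - ⟪fderiv ℝ u x (u x), u x⟫)
      (volume : Measure (Euc 3)) := i1.sub iB
  rw [integral_sub i2 iC, integral_sub i1 iB, integral_const_mul, hA, hB, hCp,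
    gradNormSq_eq_sum_pd hsm hdec]
  ring

end Summit.NavierStokesRegularity.NavierStokesRegularity.Theorems.Kosovtsov2022

end

-- WHAT THIS IS NOT: not a claim about NS regularity or blow-up; not a claim about any author beyond the typed locator.
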